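import Mathlib
import Literature.Analysis.FluidPDE.VectorCalculus
import Summits.NavierStokesRegularity.NavierStokesRegularity.Theorems.FilamentSkeletonRssSkeletonEquilibriumDihedralExclusion

/-!
# `SkeletonEquilibrium` (stmt-NavierStokesRegularity-15400): structure of mirror-reversible relative equilibria

Negative-side structural helper for the (held) support item `FilamentSkeletonRss.SkeletonEquilibrium`
(`--supports stmt-NavierStokesRegularity-15400`). Companion of the dihedral EXCLUSIONS (`…HelixExclusion`
p830741, `…HalfTurnExclusion` p830830, `…DihedralExclusion` p830893, `…DihedralRigidity` p831058): those show
that a PROPER half-turn symmetry is incompatible with the relative-equilibrium system. The symmetry the route's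
candidates actually carry (cdisprove (c4): the outer binormal-flow profiles satisfy `R_π Y(−s) = σ_z Y(s)`) is the
IMPROPER mirror `S = σ_z : (x, y, z) ↦ (x, y, −z)` in the horizontal plane through the origin, combined with
parameter/orientation reversal and an involutive relabelling `π` of the filaments (`γ ∘ π = γ`):
`Ξ_{πk}(−σ) = S Ξ_k(σ)` (coordinates: `hsym`). This symmetry IS compatible (vorticity is a pseudo-vector:
`(Sa) × (Sb) = −S(a × b)`, and `S` commutes with the Leray drift `½x − α e₃ × x`), and it imposes STRUCTURE on
any such witness, proved here from the integrability + tangency clauses alone (no differentiation of `u`):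

* `integral_apply_mirror`, `induction_apply_mirror` — `u(Sx) = S u(x)` at every field point (components;
  change of variables `σ ↦ −σ`, reindexing by `π`).
* `slip_antisymm_of_mirror` — ★ the SLIP LAW `(w_k τ + w_{πk}(−τ)) • Ξ_k′ τ = 0`, i.e. with unit speed
  `w_{πk}(−τ) = −w_k(τ)`: partner slips are odd mirror images; stagnation points of exchanged filaments are
  mirror images (`stagnation_mirror`).
* SELF-PAIRED filaments (`π k = k`): `w_k` is ODD (`slip_odd_of_self_mirror`), so `w_k(0) = 0`
  (`slip_zero_of_self_mirror`): the symmetry point IS a stagnation point; it lies ON THE MIRROR PLANE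
  (`(Ξ_k 0)₂ = 0`) and the tangent there is EXACTLY VERTICAL (`(Ξ_k′0)₀ = (Ξ_k′0)₁ = 0`,
  `apply_zero_of_self_mirror`, `deriv_zero_horizontal_of_self_mirror`); with the crux's uniqueness clause the
  unique zero `τ*` of `w_k` is `0` (`stagnation_eq_zero_of_self_mirror`), so the (SC) clause reads
  `3/2 + δ ≤ w_k′(0)` AT a point of the plane with vertical tangent (`sc_at_mirror_point`) — in this class the
  «Kelvin–sonic verticality» of the negation lines holds EXACTLY at `τ*`, and (SC) becomes (via the landed
  strain identity `w′(τ*) = ½ + ⟪Du T, T⟫`, `div u = 0`) a horizontal-CONVERGENCE requirement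
  `div_h u_h ≤ −(1 + δ)` for the induced field at a plane point — the 2-D-like target an a-priori estimate in the
  reversible class has to defeat.

Def-free (symmetry = coordinate hypotheses, `π` a bare involution); Mathlib +
`Literature.Analysis.FluidPDE.VectorCalculus` (`cross`) + `…DihedralExclusion` (`deriv_apply_neg_of_affine_relation`).
-/

-- `NavierStokesRegularity.NavierStokesRegularity` is the summit/problem path (D-0017), flagged by dupNamespace.
set_option linter.dupNamespace false

namespace Summit.NavierStokesRegularity.NavierStokesRegularity.Theorems.SkeletonEquilibrium.MirrorReversible

open Literature.Analysis.FluidPDE MeasureTheory Filter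
open scoped RealInnerProductSpace InnerProductSpace BigOperators Topology
open Summit.NavierStokesRegularity.NavierStokesRegularity.Theorems.SkeletonEquilibrium.DihedralExclusion
  (deriv_apply_neg_of_affine_relation)

/-- Components of the cross product `v × w`. [folklore] -/
private theorem cross_apply_fin3 (v w : EuclideanSpace ℝ (Fin 3)) :
    cross v w 0 = v 1 * w 2 - v 2 * w 1 ∧ cross v w 1 = v 2 * w 0 - v 0 * w 2 ∧
      cross v w 2 = v 0 * w 1 - v 1 * w 0 := by
  refine ⟨?_, ?_, ?_⟩ <;> simp [cross, cross_apply]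

/-- `⟪eᵢ, v⟫ = v i`. [folklore] -/
private theorem inner_single_left' (i : Fin 3) (v : EuclideanSpace ℝ (Fin 3)) :
    ⟪EuclideanSpace.single i (1 : ℝ), v⟫ = v i := by
  rw [EuclideanSpace.inner_single_left]; simp

/-- Components of the frame rotation `e₃ × v = (−v₁, v₀, 0)`. [folklore] -/
private theorem cross_e3_apply (v : EuclideanSpace ℝ (Fin 3)) :
    cross (EuclideanSpace.single (2 : Fin 3) (1 : ℝ)) v 0 = -v 1 ∧
      cross (EuclideanSpace.single (2 : Fin 3) (1 : ℝ)) v 1 = v 0 ∧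
      cross (EuclideanSpace.single (2 : Fin 3) (1 : ℝ)) v 2 = 0 := by
  obtain ⟨h0, h1, h2⟩ := cross_apply_fin3 (EuclideanSpace.single (2 : Fin 3) (1 : ℝ)) v
  rw [h0, h1, h2]
  refine ⟨?_, ?_, ?_⟩ <;> simp

/-- A component of a Bochner integral of an integrable `ℝ³`-valued function is the integral of the
component. [folklore] -/
private theorem integral_apply_eq {F : ℝ → EuclideanSpace ℝ (Fin 3)} (hF : Integrable F) (i : Fin 3) :
    (∫ σ, F σ) i = ∫ σ, F σ i := by
  rw [← inner_single_left' i, ← integral_inner hF]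
  exact integral_congr_ae (Eventually.of_forall fun σ => inner_single_left' i (F σ))

section Mirror

variable {N : ℕ} {Ξ : Fin N → ℝ → EuclideanSpace ℝ (Fin 3)} {π : Fin N → Fin N}
  (hd : ∀ k, Differentiable ℝ (Ξ k))
  (hsym : ∀ k σ, Ξ (π k) (-σ) 0 = Ξ k σ 0 ∧ Ξ (π k) (-σ) 1 = Ξ k σ 1 ∧ Ξ (π k) (-σ) 2 = -(Ξ k σ 2))
include hd hsym

/-- Velocity symmetry of mirror partners: `Ξ_{πk}′(−σ) = (−Ξ_k′σ₀, −Ξ_k′σ₁, Ξ_k′σ₂) = −S Ξ_k′σ`. [folklore] -/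
theorem deriv_apply_mirror (k : Fin N) (σ : ℝ) :
    deriv (Ξ (π k)) (-σ) 0 = -(deriv (Ξ k) σ 0) ∧ deriv (Ξ (π k)) (-σ) 1 = -(deriv (Ξ k) σ 1) ∧
      deriv (Ξ (π k)) (-σ) 2 = deriv (Ξ k) σ 2 := by
  refine ⟨?_, ?_, ?_⟩
  · have h := deriv_apply_neg_of_affine_relation (hd k) (hd (π k)) 0 1 0
      (fun σ' => by rw [(hsym k σ').1]; ring) σ
    linarith
  · have h := deriv_apply_neg_of_affine_relation (hd k) (hd (π k)) 1 1 0
      (fun σ' => by rw [(hsym k σ').2.1]; ring) σ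
    linarith
  · have h := deriv_apply_neg_of_affine_relation (hd k) (hd (π k)) 2 (-1) 0
      (fun σ' => by rw [(hsym k σ').2.2]; ring) σ
    linarith

/-- The induction integrand at the mirror field point `x′ = Sx`, parameter `−σ`, partner filament `πk` is `S` of
the integrand at `x`, `σ`, filament `k` (components): the pseudo-vector rule `(Sa) × (Sb) = −S(a × b)` and the
orientation reversal compensate. [folklore] -/
theorem integrand_apply_mirror (k : Fin N) (x x' : EuclideanSpace ℝ (Fin 3))
    (hx' : x' 0 = x 0 ∧ x' 1 = x 1 ∧ x' 2 = -(x 2)) (σ : ℝ) :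
    (((‖x' - Ξ (π k) (-σ)‖ ^ 2 + 1) ^ (3 / 2 : ℝ))⁻¹ •
        cross (deriv (Ξ (π k)) (-σ)) (x' - Ξ (π k) (-σ))) 0 =
      (((‖x - Ξ k σ‖ ^ 2 + 1) ^ (3 / 2 : ℝ))⁻¹ • cross (deriv (Ξ k) σ) (x - Ξ k σ)) 0 ∧
    (((‖x' - Ξ (π k) (-σ)‖ ^ 2 + 1) ^ (3 / 2 : ℝ))⁻¹ •
        cross (deriv (Ξ (π k)) (-σ)) (x' - Ξ (π k) (-σ))) 1 =
      (((‖x - Ξ k σ‖ ^ 2 + 1) ^ (3 / 2 : ℝ))⁻¹ • cross (deriv (Ξ k) σ) (x - Ξ k σ)) 1 ∧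
    (((‖x' - Ξ (π k) (-σ)‖ ^ 2 + 1) ^ (3 / 2 : ℝ))⁻¹ •
        cross (deriv (Ξ (π k)) (-σ)) (x' - Ξ (π k) (-σ))) 2 =
      -((((‖x - Ξ k σ‖ ^ 2 + 1) ^ (3 / 2 : ℝ))⁻¹ • cross (deriv (Ξ k) σ) (x - Ξ k σ)) 2) := by
  obtain ⟨hx0, hx1, hx2⟩ := hx'
  obtain ⟨hn0, hn1, hn2⟩ := hsym k σ
  obtain ⟨hd0, hd1, hd2⟩ := deriv_apply_mirror hd hsym k σ
  have hnorm : ‖x' - Ξ (π k) (-σ)‖ = ‖x - Ξ k σ‖ := by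
    rw [EuclideanSpace.norm_eq, EuclideanSpace.norm_eq]
    congr 1
    simp only [Fin.sum_univ_three, PiLp.sub_apply, hx0, hx1, hx2, hn0, hn1, hn2, Real.norm_eq_abs,
      sq_abs]
    ring
  obtain ⟨c0, c1, c2⟩ := cross_apply_fin3 (deriv (Ξ (π k)) (-σ)) (x' - Ξ (π k) (-σ))
  obtain ⟨d0, d1, d2⟩ := cross_apply_fin3 (deriv (Ξ k) σ) (x - Ξ k σ)
  simp only [PiLp.smul_apply, smul_eq_mul, hnorm, c0, c1, c2, d0, d1, d2, PiLp.sub_apply, hx0, hx1, hx2,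
    hn0, hn1, hn2, hd0, hd1, hd2]
  refine ⟨?_, ?_, ?_⟩ <;> ring

/-- **Transformation of one filament's induction under the mirror**: `u_{πk}(Sx) = S u_k(x)` (components),
given the integrability clause at `(k, x)` and `(πk, Sx)`. [folklore] -/
theorem integral_apply_mirror (k : Fin N) (x x' : EuclideanSpace ℝ (Fin 3))
    (hx' : x' 0 = x 0 ∧ x' 1 = x 1 ∧ x' 2 = -(x 2))
    (hI : Integrable (fun σ : ℝ => ((‖x - Ξ k σ‖ ^ 2 + 1) ^ (3 / 2 : ℝ))⁻¹ •
      cross (deriv (Ξ k) σ) (x - Ξ k σ)))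
    (hI' : Integrable (fun σ : ℝ => ((‖x' - Ξ (π k) σ‖ ^ 2 + 1) ^ (3 / 2 : ℝ))⁻¹ •
      cross (deriv (Ξ (π k)) σ) (x' - Ξ (π k) σ))) :
    (∫ σ : ℝ, ((‖x' - Ξ (π k) σ‖ ^ 2 + 1) ^ (3 / 2 : ℝ))⁻¹ •
        cross (deriv (Ξ (π k)) σ) (x' - Ξ (π k) σ)) 0 =
      (∫ σ : ℝ, ((‖x - Ξ k σ‖ ^ 2 + 1) ^ (3 / 2 : ℝ))⁻¹ • cross (deriv (Ξ k) σ) (x - Ξ k σ)) 0 ∧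
    (∫ σ : ℝ, ((‖x' - Ξ (π k) σ‖ ^ 2 + 1) ^ (3 / 2 : ℝ))⁻¹ •
        cross (deriv (Ξ (π k)) σ) (x' - Ξ (π k) σ)) 1 =
      (∫ σ : ℝ, ((‖x - Ξ k σ‖ ^ 2 + 1) ^ (3 / 2 : ℝ))⁻¹ • cross (deriv (Ξ k) σ) (x - Ξ k σ)) 1 ∧
    (∫ σ : ℝ, ((‖x' - Ξ (π k) σ‖ ^ 2 + 1) ^ (3 / 2 : ℝ))⁻¹ •
        cross (deriv (Ξ (π k)) σ) (x' - Ξ (π k) σ)) 2 =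
      -((∫ σ : ℝ, ((‖x - Ξ k σ‖ ^ 2 + 1) ^ (3 / 2 : ℝ))⁻¹ • cross (deriv (Ξ k) σ) (x - Ξ k σ)) 2) := by
  rw [integral_apply_eq hI' 0, integral_apply_eq hI' 1, integral_apply_eq hI' 2, integral_apply_eq hI 0,
    integral_apply_eq hI 1, integral_apply_eq hI 2,
    ← integral_neg_eq_self (fun σ => (((‖x' - Ξ (π k) σ‖ ^ 2 + 1) ^ (3 / 2 : ℝ))⁻¹ •
      cross (deriv (Ξ (π k)) σ) (x' - Ξ (π k) σ)) 0) volume,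
    ← integral_neg_eq_self (fun σ => (((‖x' - Ξ (π k) σ‖ ^ 2 + 1) ^ (3 / 2 : ℝ))⁻¹ •
      cross (deriv (Ξ (π k)) σ) (x' - Ξ (π k) σ)) 1) volume,
    ← integral_neg_eq_self (fun σ => (((‖x' - Ξ (π k) σ‖ ^ 2 + 1) ^ (3 / 2 : ℝ))⁻¹ •
      cross (deriv (Ξ (π k)) σ) (x' - Ξ (π k) σ)) 2) volume,
    ← integral_neg]
  refine ⟨integral_congr_ae (Eventually.of_forall fun σ => ?_),
    integral_congr_ae (Eventually.of_forall fun σ => ?_),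
    integral_congr_ae (Eventually.of_forall fun σ => ?_)⟩
  · exact (integrand_apply_mirror hd hsym k x x' hx' σ).1
  · exact (integrand_apply_mirror hd hsym k x x' hx' σ).2.1
  · exact (integrand_apply_mirror hd hsym k x x' hx' σ).2.2

/-- **Mirror equivariance of the total induction**: with `π` an involution and `γ_{πk} = γ_k`,
`u(Sx) = S u(x)` (components), given the integrability clause of the crux at every `(k, x)`. [folklore] -/
theorem induction_apply_mirror (hπ : ∀ k, π (π k) = k) (γ : Fin N → ℝ) (hγ : ∀ k, γ (π k) = γ k)
    (Γ : ℝ)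
    (hint : ∀ k (x : EuclideanSpace ℝ (Fin 3)), Integrable (fun σ : ℝ =>
      ((‖x - Ξ k σ‖ ^ 2 + 1) ^ (3 / 2 : ℝ))⁻¹ • cross (deriv (Ξ k) σ) (x - Ξ k σ)))
    (x x' : EuclideanSpace ℝ (Fin 3)) (hx' : x' 0 = x 0 ∧ x' 1 = x 1 ∧ x' 2 = -(x 2)) :
    (∑ k : Fin N, (Γ * γ k / (4 * Real.pi)) • ∫ σ : ℝ, ((‖x' - Ξ k σ‖ ^ 2 + 1) ^ (3 / 2 : ℝ))⁻¹ •
        cross (deriv (Ξ k) σ) (x' - Ξ k σ)) 0 =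
      (∑ k : Fin N, (Γ * γ k / (4 * Real.pi)) • ∫ σ : ℝ, ((‖x - Ξ k σ‖ ^ 2 + 1) ^ (3 / 2 : ℝ))⁻¹ •
        cross (deriv (Ξ k) σ) (x - Ξ k σ)) 0 ∧
    (∑ k : Fin N, (Γ * γ k / (4 * Real.pi)) • ∫ σ : ℝ, ((‖x' - Ξ k σ‖ ^ 2 + 1) ^ (3 / 2 : ℝ))⁻¹ •
        cross (deriv (Ξ k) σ) (x' - Ξ k σ)) 1 =
      (∑ k : Fin N, (Γ * γ k / (4 * Real.pi)) • ∫ σ : ℝ, ((‖x - Ξ k σ‖ ^ 2 + 1) ^ (3 / 2 : ℝ))⁻¹ •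
        cross (deriv (Ξ k) σ) (x - Ξ k σ)) 1 ∧
    (∑ k : Fin N, (Γ * γ k / (4 * Real.pi)) • ∫ σ : ℝ, ((‖x' - Ξ k σ‖ ^ 2 + 1) ^ (3 / 2 : ℝ))⁻¹ •
        cross (deriv (Ξ k) σ) (x' - Ξ k σ)) 2 =
      -((∑ k : Fin N, (Γ * γ k / (4 * Real.pi)) • ∫ σ : ℝ, ((‖x - Ξ k σ‖ ^ 2 + 1) ^ (3 / 2 : ℝ))⁻¹ •
        cross (deriv (Ξ k) σ) (x - Ξ k σ)) 2) := by
  set I : Fin N → EuclideanSpace ℝ (Fin 3) := fun k => ∫ σ : ℝ, ((‖x - Ξ k σ‖ ^ 2 + 1) ^ (3 / 2 : ℝ))⁻¹ •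
    cross (deriv (Ξ k) σ) (x - Ξ k σ) with hI
  set I' : Fin N → EuclideanSpace ℝ (Fin 3) := fun k => ∫ σ : ℝ, ((‖x' - Ξ k σ‖ ^ 2 + 1) ^ (3 / 2 : ℝ))⁻¹ •
    cross (deriv (Ξ k) σ) (x' - Ξ k σ) with hI'
  have hpart : ∀ k, I' (π k) 0 = I k 0 ∧ I' (π k) 1 = I k 1 ∧ I' (π k) 2 = -(I k 2) := fun k =>
    integral_apply_mirror hd hsym k x x' hx' (hint k x) (hint (π k) x')
  have hbij : Function.Bijective π := Function.Involutive.bijective hπ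
  have hcomp : ∀ (i : Fin 3) (J : Fin N → EuclideanSpace ℝ (Fin 3)),
      (∑ k : Fin N, (Γ * γ k / (4 * Real.pi)) • J k) i = ∑ k : Fin N, Γ * γ k / (4 * Real.pi) * J k i := by
    intro i J
    rw [← inner_single_left' i]
    simp_rw [inner_sum, real_inner_smul_right, inner_single_left']
  have hre : ∀ (i : Fin 3), ∑ k : Fin N, Γ * γ k / (4 * Real.pi) * I' k i =
      ∑ k : Fin N, Γ * γ (π k) / (4 * Real.pi) * I' (π k) i := fun i =>
    (Fintype.sum_bijective π hbij (fun k => Γ * γ (π k) / (4 * Real.pi) * I' (π k) i)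
      (fun k => Γ * γ k / (4 * Real.pi) * I' k i) (fun k => rfl)).symm
  change (∑ k : Fin N, (Γ * γ k / (4 * Real.pi)) • I' k) 0 = (∑ k : Fin N, (Γ * γ k / (4 * Real.pi)) • I k) 0 ∧
    (∑ k : Fin N, (Γ * γ k / (4 * Real.pi)) • I' k) 1 = (∑ k : Fin N, (Γ * γ k / (4 * Real.pi)) • I k) 1 ∧
    (∑ k : Fin N, (Γ * γ k / (4 * Real.pi)) • I' k) 2 = -((∑ k : Fin N, (Γ * γ k / (4 * Real.pi)) • I k) 2)
  rw [hcomp 0 I', hcomp 0 I, hcomp 1 I', hcomp 1 I, hcomp 2 I', hcomp 2 I, hre 0, hre 1, hre 2,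
    ← Finset.sum_neg_distrib]
  refine ⟨Finset.sum_congr rfl fun k _ => ?_, Finset.sum_congr rfl fun k _ => ?_,
    Finset.sum_congr rfl fun k _ => ?_⟩
  · rw [hγ k, (hpart k).1]
  · rw [hγ k, (hpart k).2.1]
  · rw [hγ k, (hpart k).2.2]; ring

/-- ★ **Slip law of a mirror-reversible relative equilibrium.** If the tangency clause of
`SkeletonEquilibrium` holds at every `(k, τ)`, then `(w_k τ + w_{πk}(−τ)) • Ξ_k′ τ = 0` for all `k, τ`:
mirror-partner slips are odd images of each other (`S` applied to the identity at `(k, τ)` IS the identity at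
`(πk, −τ)` up to the sign of the slip). [folklore] -/
theorem slip_antisymm_of_mirror (hπ : ∀ k, π (π k) = k) (γ : Fin N → ℝ) (hγ : ∀ k, γ (π k) = γ k)
    (Γ α : ℝ) (w : Fin N → ℝ → ℝ)
    (hint : ∀ k (x : EuclideanSpace ℝ (Fin 3)), Integrable (fun σ : ℝ =>
      ((‖x - Ξ k σ‖ ^ 2 + 1) ^ (3 / 2 : ℝ))⁻¹ • cross (deriv (Ξ k) σ) (x - Ξ k σ)))
    (heq : ∀ k τ, (∑ m : Fin N, (Γ * γ m / (4 * Real.pi)) • ∫ σ : ℝ,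
        ((‖Ξ k τ - Ξ m σ‖ ^ 2 + 1) ^ (3 / 2 : ℝ))⁻¹ • cross (deriv (Ξ m) σ) (Ξ k τ - Ξ m σ)) +
        (1 / 2 : ℝ) • Ξ k τ - α • cross (EuclideanSpace.single (2 : Fin 3) (1 : ℝ)) (Ξ k τ) =
        w k τ • deriv (Ξ k) τ)
    (k : Fin N) (τ : ℝ) :
    (w k τ + w (π k) (-τ)) • deriv (Ξ k) τ = 0 := by
  have hx' : Ξ (π k) (-τ) 0 = Ξ k τ 0 ∧ Ξ (π k) (-τ) 1 = Ξ k τ 1 ∧ Ξ (π k) (-τ) 2 = -(Ξ k τ 2) :=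
    hsym k τ
  obtain ⟨hu0, hu1, hu2⟩ := induction_apply_mirror hd hsym hπ γ hγ Γ hint (Ξ k τ) (Ξ (π k) (-τ)) hx'
  obtain ⟨hd0, hd1, hd2⟩ := deriv_apply_mirror hd hsym k τ
  obtain ⟨hJ0, hJ1, hJ2⟩ := cross_e3_apply (Ξ k τ)
  obtain ⟨hJ0', hJ1', hJ2'⟩ := cross_e3_apply (Ξ (π k) (-τ))
  have h1 := heq k τ
  have h2 := heq (π k) (-τ)
  have c1 := fun i => congrArg (fun v => ⟪EuclideanSpace.single i (1 : ℝ), v⟫) h1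
  have c2 := fun i => congrArg (fun v => ⟪EuclideanSpace.single i (1 : ℝ), v⟫) h2
  have e10 := c1 0
  have e11 := c1 1
  have e12 := c1 2
  have e20 := c2 0
  have e21 := c2 1
  have e22 := c2 2
  simp only [inner_add_right, inner_sub_right, real_inner_smul_right, inner_single_left'] at e10 e11 e12
  simp only [inner_add_right, inner_sub_right, real_inner_smul_right, inner_single_left'] at e20 e21 e22
  rw [hu0, hJ0', hx'.1, hx'.2.1, hd0] at e20
  rw [hu1, hJ1', hx'.2.1, hx'.1, hd1] at e21
  rw [hu2, hJ2', hx'.2.2, hd2] at e22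
  rw [hJ0] at e10
  rw [hJ1] at e11
  rw [hJ2] at e12
  have s0 : (w k τ + w (π k) (-τ)) * deriv (Ξ k) τ 0 = 0 := by linear_combination e20 - e10
  have s1 : (w k τ + w (π k) (-τ)) * deriv (Ξ k) τ 1 = 0 := by linear_combination e21 - e11
  have s2 : (w k τ + w (π k) (-τ)) * deriv (Ξ k) τ 2 = 0 := by linear_combination -(e12 + e22)
  ext i
  fin_cases i
  · simpa using s0
  · simpa using s1
  · simpa using s2

/-- With the unit-speed clause: `w_{πk}(−τ) = −w_k(τ)`. [folklore] -/
theorem slip_mirror (hπ : ∀ k, π (π k) = k) (γ : Fin N → ℝ) (hγ : ∀ k, γ (π k) = γ k)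
    (Γ α : ℝ) (w : Fin N → ℝ → ℝ) (hunit : ∀ k τ, ‖deriv (Ξ k) τ‖ = 1)
    (hint : ∀ k (x : EuclideanSpace ℝ (Fin 3)), Integrable (fun σ : ℝ =>
      ((‖x - Ξ k σ‖ ^ 2 + 1) ^ (3 / 2 : ℝ))⁻¹ • cross (deriv (Ξ k) σ) (x - Ξ k σ)))
    (heq : ∀ k τ, (∑ m : Fin N, (Γ * γ m / (4 * Real.pi)) • ∫ σ : ℝ,
        ((‖Ξ k τ - Ξ m σ‖ ^ 2 + 1) ^ (3 / 2 : ℝ))⁻¹ • cross (deriv (Ξ m) σ) (Ξ k τ - Ξ m σ)) +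
        (1 / 2 : ℝ) • Ξ k τ - α • cross (EuclideanSpace.single (2 : Fin 3) (1 : ℝ)) (Ξ k τ) =
        w k τ • deriv (Ξ k) τ)
    (k : Fin N) (τ : ℝ) : w (π k) (-τ) = -(w k τ) := by
  have h := slip_antisymm_of_mirror hd hsym hπ γ hγ Γ α w hint heq k τ
  have hne : deriv (Ξ k) τ ≠ 0 := by
    intro h0; have := hunit k τ; rw [h0, norm_zero] at this; exact zero_ne_one this
  have hs : w k τ + w (π k) (-τ) = 0 := by
    rcases smul_eq_zero.mp h with hs | hs
    · exact hs
    · exact absurd hs hne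
  linarith

/-- Stagnation points of mirror partners are mirror images: `w_k(τ*) = 0 ⇒ w_{πk}(−τ*) = 0`. [folklore] -/
theorem stagnation_mirror (hπ : ∀ k, π (π k) = k) (γ : Fin N → ℝ) (hγ : ∀ k, γ (π k) = γ k)
    (Γ α : ℝ) (w : Fin N → ℝ → ℝ) (hunit : ∀ k τ, ‖deriv (Ξ k) τ‖ = 1)
    (hint : ∀ k (x : EuclideanSpace ℝ (Fin 3)), Integrable (fun σ : ℝ =>
      ((‖x - Ξ k σ‖ ^ 2 + 1) ^ (3 / 2 : ℝ))⁻¹ • cross (deriv (Ξ k) σ) (x - Ξ k σ)))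
    (heq : ∀ k τ, (∑ m : Fin N, (Γ * γ m / (4 * Real.pi)) • ∫ σ : ℝ,
        ((‖Ξ k τ - Ξ m σ‖ ^ 2 + 1) ^ (3 / 2 : ℝ))⁻¹ • cross (deriv (Ξ m) σ) (Ξ k τ - Ξ m σ)) +
        (1 / 2 : ℝ) • Ξ k τ - α • cross (EuclideanSpace.single (2 : Fin 3) (1 : ℝ)) (Ξ k τ) =
        w k τ • deriv (Ξ k) τ)
    (k : Fin N) (τs : ℝ) (hz : w k τs = 0) : w (π k) (-τs) = 0 := by
  rw [slip_mirror hd hsym hπ γ hγ Γ α w hunit hint heq k τs, hz, neg_zero]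

/-- SELF-PAIRED filaments (`π k = k`): the symmetry point lies on the mirror plane, `(Ξ_k 0)₂ = 0`, and the
tangent there is exactly VERTICAL, `(Ξ_k′ 0)₀ = (Ξ_k′ 0)₁ = 0` (pure symmetry, no equation needed). [folklore] -/
theorem apply_zero_of_self_mirror (k : Fin N) (hk : π k = k) :
    Ξ k 0 2 = 0 ∧ deriv (Ξ k) 0 0 = 0 ∧ deriv (Ξ k) 0 1 = 0 := by
  obtain ⟨_, _, h2⟩ := hsym k 0
  obtain ⟨hd0, hd1, _⟩ := deriv_apply_mirror hd hsym k 0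
  rw [neg_zero, hk] at h2 hd0 hd1
  refine ⟨?_, ?_, ?_⟩ <;> linarith

/-- Exact «Kelvin–sonic verticality» at the symmetry point of a self-paired filament:
`Ξ_k′(0) × e₃ = 0`. [folklore] -/
theorem deriv_zero_cross_e3_of_self_mirror (k : Fin N) (hk : π k = k) :
    cross (deriv (Ξ k) 0) (EuclideanSpace.single (2 : Fin 3) (1 : ℝ)) = 0 := by
  obtain ⟨_, hd0, hd1⟩ := apply_zero_of_self_mirror hd hsym k hk
  obtain ⟨c0, c1, c2⟩ := cross_apply_fin3 (deriv (Ξ k) 0) (EuclideanSpace.single (2 : Fin 3) (1 : ℝ))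
  ext i
  fin_cases i
  · simp only [PiLp.zero_apply]; simp [c0, hd1]
  · simp only [PiLp.zero_apply]; simp [c1, hd0]
  · simp only [PiLp.zero_apply]; simp [c2, hd0, hd1]

/-- ★ SELF-PAIRED filaments: the slip is ODD, `w_k(−τ) = −w_k(τ)`; in particular `w_k(0) = 0` — the symmetry
point is a stagnation point. [folklore] -/
theorem slip_odd_of_self_mirror (hπ : ∀ k, π (π k) = k) (γ : Fin N → ℝ) (hγ : ∀ k, γ (π k) = γ k)
    (Γ α : ℝ) (w : Fin N → ℝ → ℝ) (hunit : ∀ k τ, ‖deriv (Ξ k) τ‖ = 1)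
    (hint : ∀ k (x : EuclideanSpace ℝ (Fin 3)), Integrable (fun σ : ℝ =>
      ((‖x - Ξ k σ‖ ^ 2 + 1) ^ (3 / 2 : ℝ))⁻¹ • cross (deriv (Ξ k) σ) (x - Ξ k σ)))
    (heq : ∀ k τ, (∑ m : Fin N, (Γ * γ m / (4 * Real.pi)) • ∫ σ : ℝ,
        ((‖Ξ k τ - Ξ m σ‖ ^ 2 + 1) ^ (3 / 2 : ℝ))⁻¹ • cross (deriv (Ξ m) σ) (Ξ k τ - Ξ m σ)) +
        (1 / 2 : ℝ) • Ξ k τ - α • cross (EuclideanSpace.single (2 : Fin 3) (1 : ℝ)) (Ξ k τ) =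
        w k τ • deriv (Ξ k) τ)
    (k : Fin N) (hk : π k = k) :
    (∀ τ, w k (-τ) = -(w k τ)) ∧ w k 0 = 0 := by
  have hodd : ∀ τ, w k (-τ) = -(w k τ) := by
    intro τ
    have h := slip_mirror hd hsym hπ γ hγ Γ α w hunit hint heq k τ
    rwa [hk] at h
  refine ⟨hodd, ?_⟩
  have h0 := hodd 0
  rw [neg_zero] at h0
  linarith

/-- ★ SELF-PAIRED filaments under the crux's stagnation clause: the UNIQUE zero `τ*` of `w_k` is the symmetry
point, `τ* = 0`; hence the supercritical-stretching clause holds AT a point of the mirror plane where the tangent is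
exactly vertical: `3/2 + δ ≤ w_k′(0)`, `(Ξ_k 0)₂ = 0`, `Ξ_k′ 0 × e₃ = 0`. [folklore] -/
theorem sc_at_mirror_point (hπ : ∀ k, π (π k) = k) (γ : Fin N → ℝ) (hγ : ∀ k, γ (π k) = γ k)
    (Γ α δ : ℝ) (w : Fin N → ℝ → ℝ) (hunit : ∀ k τ, ‖deriv (Ξ k) τ‖ = 1)
    (hint : ∀ k (x : EuclideanSpace ℝ (Fin 3)), Integrable (fun σ : ℝ =>
      ((‖x - Ξ k σ‖ ^ 2 + 1) ^ (3 / 2 : ℝ))⁻¹ • cross (deriv (Ξ k) σ) (x - Ξ k σ)))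
    (heq : ∀ k τ, (∑ m : Fin N, (Γ * γ m / (4 * Real.pi)) • ∫ σ : ℝ,
        ((‖Ξ k τ - Ξ m σ‖ ^ 2 + 1) ^ (3 / 2 : ℝ))⁻¹ • cross (deriv (Ξ m) σ) (Ξ k τ - Ξ m σ)) +
        (1 / 2 : ℝ) • Ξ k τ - α • cross (EuclideanSpace.single (2 : Fin 3) (1 : ℝ)) (Ξ k τ) =
        w k τ • deriv (Ξ k) τ)
    (k : Fin N) (hk : π k = k) (τs : ℝ)
    (hstag : w k τs = 0 ∧ (∀ τ, w k τ = 0 → τ = τs) ∧ 3 / 2 + δ ≤ deriv (w k) τs) :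
    τs = 0 ∧ 3 / 2 + δ ≤ deriv (w k) 0 ∧ Ξ k 0 2 = 0 ∧
      cross (deriv (Ξ k) 0) (EuclideanSpace.single (2 : Fin 3) (1 : ℝ)) = 0 := by
  obtain ⟨_, huniq, hsc⟩ := hstag
  have h0 : w k 0 = 0 := (slip_odd_of_self_mirror hd hsym hπ γ hγ Γ α w hunit hint heq k hk).2
  have hτ : τs = 0 := (huniq 0 h0).symm
  subst hτ
  exact ⟨rfl, hsc, (apply_zero_of_self_mirror hd hsym k hk).1,
    deriv_zero_cross_e3_of_self_mirror hd hsym k hk⟩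

end Mirror

end Summit.NavierStokesRegularity.NavierStokesRegularity.Theorems.SkeletonEquilibrium.MirrorReversible
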